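/-
Copyright (c) 2026 the pub-hodgecm-mathlib formalisation cell (harness21).  Prover seat hodgecm-mathlib-K2Liu-p14 (g3), Track B «K2-LIT»,
#184♮ = hLiu418 = `stmt-HodgeConjecture-24832`; Road I v3, S5-F3 lineage ∕ I4-conv (F′-fact), FILE E part 1b: the archimedean letter for the Klingen Levi `m_Q(1, ·)`.
-/
import Summits.HodgeConjecture.HodgeConjecture.Theorems.K2LiuKlingenInnerSectionShape   -- ★ E part 1: `archPart_eq_of_map_fst_eq`, arch letters for `n_Q` (+ ★ B, ★ B2)
import HarnessLib

/-!
# Crux `HLiu418`, I4-conv (F′-fact), FILE E part 1b — `K2LiuKlingenInnerSectionShapeArch`: `(m_Q(1, j₂⁻¹ g₂))_∞` DEPENDS ONLY ON `(g₂)_∞`, and the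
# `T′`-part of the term-2 integrand sees `g₂` only through `((g₂)_∞, ((g₂)_v)_{v ∈ T′})`

Cell `hodgecm-mathlib`, crux item hLiu418 = `stmt-HodgeConjecture-24832`; squad K2 ∕ K2Liu; LEAD F0P6-plan (g14) BATCH #36 (E = mine); prover K2Liu-p14 (g3).
THEOREMS ONLY (no `def`, no instance, no notation, no named-fact hypothesis, no `sorry`); lane `--supports stmt-HodgeConjecture-24832 --as helper` (count-neutral).

WHY.  The census architecture («WRITE the factorizable line family `g s′ x := gT′ s′ (x_∞, x_{T′}) · ∏ᶠ_{v∉T′} Λ^{line}_{s′,v}(x_v)`, PROVE `F′_{h,f_s} ∘ Ψ_S⁻¹ = g (s−½)`»)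
needs the `T′`-part `I` of ★∕📤 E part 2 `innerSection_eq_mul_tprod_mul_finprod_psiLoc` to be a FUNCTION of `((Ψ_S g₂)_∞, ((Ψ_S g₂)_v)_{v∈T′})`.  By ★ E part 1
`integrand_eq_mul_finprod` the `T′`-part integrand is `fT_s(A_∞, (A_v)_{v∈T′})`, `A = Ψ(ξ)·Ψ(n_Q(y,0,t))·(Ψ(m_Q(1,j₂⁻¹g₂))·h)`; its finite components at `v ∈ T′` see `g₂` through
`(g₂)_v` (★ B `evalPlace_finPart_klingenLevi_one`), and this file shows that its archimedean component sees `g₂` through `(g₂)_∞` only: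
* `map_fst_eq_of_archPart_eq` (converse of ★ E part 1 `archPart_eq_of_map_fst_eq`: `g_∞ = g'_∞ ⇒` the infinite parts of the entries agree — ★ `GLn.infiniteEquivMixed` is a
  bijection), `apply_klingenLeviM_one_congr` (generic ring: a ring homomorphism that identifies the entries of `g, g'` identifies the entries of `m_Q(1,g), m_Q(1,g')`),
* **`archPart_jAdelic_klingenLevi_one_eq_of_archPart_eq`** (`(g₂)_∞ = (g₂')_∞ ⇒ (m_Q(1,j₂⁻¹g₂))_∞ = (m_Q(1,j₂⁻¹g₂'))_∞`),
* **`archPart_arg_eq_of_archPart_eq`** (for a pinned `Ψ`: `(Ψ(m_Q(1,j₂⁻¹g₂)) · h)_∞` depends only on `(g₂)_∞`, ★ B2 `archPart_eq_archPart_archToAdelic`).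
[BorelJacquet1979, §4.1], [MoeglinWaldspurger1995, II.1.7], [Xiong2013, §7 Lemma 7.1].
HONEST LABEL.  Count-neutral helper, closes no socket: `HC_CM` is proved only modulo the 7 printed citations (2 remaining named inputs: hLiu418 =
`stmt-HodgeConjecture-24832`, h413 = `stmt-HodgeConjecture-24833`) until rung 0 closes.
-/

set_option autoImplicit false
set_option linter.dupNamespace false -- the mandated namespace repeats `HodgeConjecture.HodgeConjecture`

noncomputable section

open scoped Matrix
open NumberField IsDedekindDomain

namespace Summit.HodgeConjecture.HodgeConjecture.Cruxes.HLiu418.K2LiuKlingenInnerSectionShapeArch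

open Literature.NumberTheory.Automorphic Literature.NumberTheory.Automorphic.UnitaryGroup
open Literature.NumberTheory.GelbartRogawski1991 Literature.NumberTheory.GelbartRogawski1991.GRConstruction
open Summit.HodgeConjecture.HodgeConjecture.Cruxes.HLiu418.K2LiuKlingenParabolicDefs
open Summit.HodgeConjecture.HodgeConjecture.Cruxes.HLiu418.K2LiuKlingenUnipotentAdelicDefs
open Summit.HodgeConjecture.HodgeConjecture.Cruxes.HLiu418.K2LiuSiegelDoubledLeviMatrix (conjAdele_conjAdele')
open Summit.HodgeConjecture.HodgeConjecture.Cruxes.HLiu418.K2LiuKlingenInnerSectionLocalTransport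
open Summit.HodgeConjecture.HodgeConjecture.Cruxes.HLiu418.K2LiuKlingenInnerSectionShape

variable (L : Type) [Field L] [NumberField L] [IsCMField L]

/-- **`g_∞ = g'_∞` ⇒ the infinite parts of the entries of `g, g'` agree** (★ `GLn.toMixed = infiniteEquivMixed ∘ fstHom`, `infiniteEquivMixed` a bijection).
[cite: BorelJacquet1979, §4.1] -/
theorem map_fst_eq_of_archPart_eq {N : ℕ} {J : Matrix (Fin N) (Fin N) L} {g g' : (adelicGroupData (Fp L) L (IsCMField.complexConj L) N J).Adelic}
    (h : UnitaryGroup.archPart (Fp L) L (IsCMField.complexConj L) N J g = UnitaryGroup.archPart (Fp L) L (IsCMField.complexConj L) N J g') :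
    ((g.1 : GL (Fin N) (AdeleRing (𝓞 L) L)) : Matrix (Fin N) (Fin N) (AdeleRing (𝓞 L) L)).map Prod.fst =
      ((g'.1 : GL (Fin N) (AdeleRing (𝓞 L) L)) : Matrix (Fin N) (Fin N) (AdeleRing (𝓞 L) L)).map Prod.fst := by
  have h1 := congrArg (fun a : ↥(UnitaryGroup.arch (Fp L) L (IsCMField.complexConj L) N J) => (a : GL (Fin N) (NumberField.mixedEmbedding.mixedSpace L))) h
  simp only [UnitaryGroup.coe_archPart, adelicVal_apply, GLn.toMixed_apply] at h1
  have h2 : GLn.fstHom N L g.1 = GLn.fstHom N L g'.1 := (GLn.infiniteEquivMixed N L).injective h1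
  exact congrArg (fun u : GL (Fin N) (InfiniteAdeleRing L) => (u : Matrix (Fin N) (Fin N) (InfiniteAdeleRing L))) h2

omit [IsCMField L] in
/-- a ring homomorphism identifying the entries of `g` and `g'` identifies the entries of `m_Q(1,g)` and `m_Q(1,g')` (entries `1, 0, g_{ab}, σ(1⁻¹)`). [cite: Xiong2013, §7 Lemma 7.1] -/
theorem apply_klingenLeviM_one_congr {R R' : Type*} [CommRing R] [CommRing R'] (σ : R →+* R) (f : R →+* R')
    (g g' : unitaryGroupOfForm σ ((StdForm.antidiagonal 2).over R)) (hg : ∀ a b, f ((g : GL (Fin 2) R).val a b) = f ((g' : GL (Fin 2) R).val a b)) (i j : Fin 4) :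
    f (klingenLeviM R σ 1 g i j) = f (klingenLeviM R σ 1 g' i j) := by
  fin_cases i <;> fin_cases j <;> simp [klingenLeviM, hg]

/-- **`(g₂)_∞ = (g₂')_∞ ⇒ (m_Q(1, j₂⁻¹ g₂))_∞ = (m_Q(1, j₂⁻¹ g₂'))_∞`** (★ E part 1 `archPart_eq_of_map_fst_eq`; ★ `coe_adelicVal_jAdelic`, ★ `coe_klingenLevi`).
[cite: BorelJacquet1979, §4.1] [cite: MoeglinWaldspurger1995, II.1.7] -/
theorem archPart_jAdelic_klingenLevi_one_eq_of_archPart_eq {g₂ g₂' : (quasiSplit (Fp L) L (IsCMField.complexConj L) 2).Adelic}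
    (h : UnitaryGroup.archPart (Fp L) L (IsCMField.complexConj L) 2 ((StdForm.antidiagonal 2).over L) g₂ =
      UnitaryGroup.archPart (Fp L) L (IsCMField.complexConj L) 2 ((StdForm.antidiagonal 2).over L) g₂') :
    UnitaryGroup.archPart (Fp L) L (IsCMField.complexConj L) 4 ((StdForm.antidiagonal 4).over L)
        (jAdelic L 4 (klingenLevi (AdeleRing (𝓞 L) L) (conjAdele (Fp L) L (IsCMField.complexConj L)) (conjAdele_conjAdele' L) 1 ((jAdelic L 2).symm g₂))) =
      UnitaryGroup.archPart (Fp L) L (IsCMField.complexConj L) 4 ((StdForm.antidiagonal 4).over L)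
        (jAdelic L 4 (klingenLevi (AdeleRing (𝓞 L) L) (conjAdele (Fp L) L (IsCMField.complexConj L)) (conjAdele_conjAdele' L) 1 ((jAdelic L 2).symm g₂'))) := by
  have hfst := map_fst_eq_of_archPart_eq L h
  have hg : ∀ a b, (RingHom.fst (InfiniteAdeleRing L) (FiniteAdeleRing (𝓞 L) L))
      ((((jAdelic L 2).symm g₂ : unitaryGroupOfForm (conjAdele (Fp L) L (IsCMField.complexConj L)) ((StdForm.antidiagonal 2).over (AdeleRing (𝓞 L) L))) :
        GL (Fin 2) (AdeleRing (𝓞 L) L)).val a b) =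
      (RingHom.fst (InfiniteAdeleRing L) (FiniteAdeleRing (𝓞 L) L))
      ((((jAdelic L 2).symm g₂' : unitaryGroupOfForm (conjAdele (Fp L) L (IsCMField.complexConj L)) ((StdForm.antidiagonal 2).over (AdeleRing (𝓞 L) L))) :
        GL (Fin 2) (AdeleRing (𝓞 L) L)).val a b) := by
    intro a b
    have e1 : ((((jAdelic L 2).symm g₂ : unitaryGroupOfForm (conjAdele (Fp L) L (IsCMField.complexConj L)) ((StdForm.antidiagonal 2).over (AdeleRing (𝓞 L) L))) :
        GL (Fin 2) (AdeleRing (𝓞 L) L)).val) = ((g₂.1 : GL (Fin 2) (AdeleRing (𝓞 L) L)) : Matrix (Fin 2) (Fin 2) (AdeleRing (𝓞 L) L)) := by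
      rw [← coe_adelicVal_jAdelic L 2 ((jAdelic L 2).symm g₂), MulEquiv.apply_symm_apply, adelicVal_apply]
    have e2 : ((((jAdelic L 2).symm g₂' : unitaryGroupOfForm (conjAdele (Fp L) L (IsCMField.complexConj L)) ((StdForm.antidiagonal 2).over (AdeleRing (𝓞 L) L))) :
        GL (Fin 2) (AdeleRing (𝓞 L) L)).val) = ((g₂'.1 : GL (Fin 2) (AdeleRing (𝓞 L) L)) : Matrix (Fin 2) (Fin 2) (AdeleRing (𝓞 L) L)) := by
      rw [← coe_adelicVal_jAdelic L 2 ((jAdelic L 2).symm g₂'), MulEquiv.apply_symm_apply, adelicVal_apply]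
    have h3 := congrFun (congrFun hfst a) b
    rw [Matrix.map_apply, Matrix.map_apply] at h3
    rw [e1, e2]
    exact h3
  refine archPart_eq_of_map_fst_eq L _ _ ?_
  rw [← adelicVal_apply, coe_adelicVal_jAdelic, coe_klingenLevi, ← adelicVal_apply, coe_adelicVal_jAdelic, coe_klingenLevi]
  ext i j
  exact apply_klingenLeviM_one_congr (conjAdele (Fp L) L (IsCMField.complexConj L)) (RingHom.fst (InfiniteAdeleRing L) (FiniteAdeleRing (𝓞 L) L)) _ _ hg i j

/-- **the archimedean component of `Ψ(m_Q(1, j₂⁻¹ g₂)) · h` depends only on `(g₂)_∞`** for a pinned `Ψ` (★ B2 `archPart_eq_archPart_archToAdelic`). Together with ★ E part 1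
`archPart_arg_eq_of_fst_eq` (dependence on `(y_∞, t_∞)`): the `T′`-part integrand of term 2 sees `(q, g₂)` only through their archimedean and `T′` components.
[cite: BorelJacquet1979, §4.1] [cite: MoeglinWaldspurger1995, II.1.7] -/
theorem archPart_arg_eq_of_archPart_eq {J' : Matrix (Fin 4) (Fin 4) L}
    (Ψ : (adelicGroupData (Fp L) L (IsCMField.complexConj L) 4 ((StdForm.antidiagonal 4).over L)).Adelic →* (adelicGroupData (Fp L) L (IsCMField.complexConj L) 4 J').Adelic)
    (SA : GL (Fin 4) (AdeleRing (𝓞 L) L))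
    (hΨ : ∀ g : (adelicGroupData (Fp L) L (IsCMField.complexConj L) 4 ((StdForm.antidiagonal 4).over L)).Adelic,
      (((Ψ g).1 : GL (Fin 4) (AdeleRing (𝓞 L) L)) : Matrix (Fin 4) (Fin 4) (AdeleRing (𝓞 L) L)) =
        (SA : Matrix (Fin 4) (Fin 4) (AdeleRing (𝓞 L) L)) *
          ((adelicVal (Fp L) L (IsCMField.complexConj L) 4 ((StdForm.antidiagonal 4).over L) g : GL (Fin 4) (AdeleRing (𝓞 L) L)) :
            Matrix (Fin 4) (Fin 4) (AdeleRing (𝓞 L) L)) *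
          ((SA⁻¹ : GL (Fin 4) (AdeleRing (𝓞 L) L)) : Matrix (Fin 4) (Fin 4) (AdeleRing (𝓞 L) L)))
    {g₂ g₂' : (quasiSplit (Fp L) L (IsCMField.complexConj L) 2).Adelic}
    (h : UnitaryGroup.archPart (Fp L) L (IsCMField.complexConj L) 2 ((StdForm.antidiagonal 2).over L) g₂ =
      UnitaryGroup.archPart (Fp L) L (IsCMField.complexConj L) 2 ((StdForm.antidiagonal 2).over L) g₂')
    (a b : (adelicGroupData (Fp L) L (IsCMField.complexConj L) 4 J').Adelic) :
    UnitaryGroup.archPart (Fp L) L (IsCMField.complexConj L) 4 J'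
        (a * (Ψ (jAdelic L 4 (klingenLevi (AdeleRing (𝓞 L) L) (conjAdele (Fp L) L (IsCMField.complexConj L)) (conjAdele_conjAdele' L) 1 ((jAdelic L 2).symm g₂))) * b)) =
      UnitaryGroup.archPart (Fp L) L (IsCMField.complexConj L) 4 J'
        (a * (Ψ (jAdelic L 4 (klingenLevi (AdeleRing (𝓞 L) L) (conjAdele (Fp L) L (IsCMField.complexConj L)) (conjAdele_conjAdele' L) 1 ((jAdelic L 2).symm g₂'))) * b)) := by
  rw [map_mul, map_mul, map_mul, map_mul, archPart_eq_archPart_archToAdelic L Ψ SA hΨ (jAdelic L 4 (klingenLevi _ _ _ 1 ((jAdelic L 2).symm g₂))),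
    archPart_eq_archPart_archToAdelic L Ψ SA hΨ (jAdelic L 4 (klingenLevi _ _ _ 1 ((jAdelic L 2).symm g₂'))), archPart_jAdelic_klingenLevi_one_eq_of_archPart_eq L h]

end Summit.HodgeConjecture.HodgeConjecture.Cruxes.HLiu418.K2LiuKlingenInnerSectionShapeArch

end
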